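import Literature.AlgebraicGeometry.HodgeTheory.ProjectiveModelDiagonalSymmetry
import Literature.Geometry.Kaehler.HolomorphicTopFormsLine
import HarnessLib

/-!
# The residue form `Res(Ω/F)` of a hypersurface of degree `d = m + 2`: nowhere zero, spans the holomorphic top forms, transforms by `det` under diagonal symmetries

Family `hodge`, layer `Literature/AlgebraicGeometry/HodgeTheory`. PROOF FILE (theorems only; no
definition, no named fact — D-0026), in the setting of `HypersurfaceResidueFormDef` /
`ProjectiveModelDiagonalSymmetry`: `F ∈ ℂ[X₀, …, X_{m+1}]` homogeneous with non-vanishing gradient on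
its cone, `M` a complex manifold charted on `E` (`dim_ℂ E = m`) with a topological embedding
`ψ : M → ℙ(ℂ^{m+2})` onto/into `V(F)` whose affine coordinates are holomorphic, and a holomorphic
self-map `Φ` lying over the diagonal symmetry `[z] ↦ [a • z]`, `F(a • z) = F(z)`. This file treats
the **canonical degree `d = m + 2`** (`K_Y = 𝒪_Y(d - m - 2) = 𝒪_Y`: Calabi–Yau hypersurfaces — the
plane cubic, the quartic surface, the quintic threefold, the sextic fourfold), where Griffiths'
residue `Res_Y(Ω/F)` (`residueForm ψ F 1`, numerator `P = 1`) is a holomorphic `m`-form: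

* `mul_eval_pderiv_smul_of_eval_smul_eq` — the gradient of an `a`-invariant form is `a`-covariant:
  `a_j · (∂_jF)(a • z) = (∂_jF)(z)` (chain rule; any degree);
* `eval_pderiv_diagScale`, `normalVec_diagScale` — hence, on the normalised lifts
  `Z̃ᵢ(Φ x) = (a/aᵢ) · Z̃ᵢ x`, the normal vector `N_j = e_j/∂_jF` scales as
  `N_j((a/aᵢ) z) = aᵢᵈ · (a/aᵢ) · N_j(z)` (any degree `d ≥ 1`);
* `pullback_residueFormula_one_symm_of_smul` — the local residue form under `Φ` when the normal
  vector scales with an extra constant `c`: `Φ^* ω = (c · ∏_k a_k/a_i) • ω` at `x` (the version of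
  `pullback_residueFormula_one_symm` without the hypothesis `aᵢᵈ = 1`);
* `pullback_residueForm_one_symm` — **for `d = m + 2`: `Φ^* Res(Ω/F) = (∏_k a_k) • Res(Ω/F)`**
  globally on `M` (`aᵢ^{m+2} · ∏_k a_k/a_i = ∏_k a_k = det(diag a)`); in print
  `g^* Res(Ω/F) = det(g) · Res(Ω/F)` for a linear symmetry `g` of `F` (Voisin II, §6.1.3: the residue
  map is equivariant and `g^*Ω = det(g) Ω`; Shioda 1979, §1 (1.7) for the diagonal group of the
  Fermat variety);
* `residueForm_one_ne_zero`, `isHolomorphicInCharts_residueForm_one` — for `d = m + 2` the form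
  `Res(Ω/F)` is holomorphic in charts and vanishes NOWHERE on `M` (`residueForm_ne_zero` with
  `P = X_{i₀}⁰ = 1` at every point; Voisin II, Cor. 6.12 at `p = 1`: `R_F⁰ = ℂ ↪ H^{m,0}`), i.e.
  it trivialises the canonical bundle of `M`;
* `exists_eq_const_smul_residueForm_one` — so on a COMPACT CONNECTED model every holomorphic
  `m`-form is `c • Res(Ω/F)` (`Literature.Geometry.Kaehler.exists_eq_const_smul_of_isHolomorphicInCharts`:
  `H⁰(K) = ℂ · Res(Ω/F)`, `p_g = 1`; Voisin II, Cor. 6.12 at `p = 1` with `R_F^{d-m-2} = R_F⁰ = ℂ`);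
* `pullback_eq_prod_smul_of_isHolomorphicInCharts`, `eq_zero_of_pullback_eq_smul_of_ne` — hence
  `Φ^* η = (∏_k a_k) • η` for EVERY holomorphic `m`-form `η`, and an eigenform of `Φ` with
  eigenvalue `χ ≠ ∏_k a_k` vanishes: **`H^{m,0}` of a Calabi–Yau hypersurface is the character
  `det` of its group of diagonal symmetries** (Shioda (1.7): `V(α) ⊂ H^{n,0}(Xⁿₘ)` iff
  `α = (1, …, 1)`; Katz 2009, §3 / Lemma 3.1 for the Dwork family, where `∏ aᵢ = 1` on `Γ_W`).

## References

* [VoisinHodgeII2003] C. Voisin, Hodge Theory and Complex Algebraic Geometry II (2003), §6.1.1,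
  §6.1.3, Thm. 6.10, Cor. 6.12.
* [Shioda1979HodgeFermat] T. Shioda, The Hodge conjecture for Fermat varieties, Math. Ann. 245
  (1979) 175–184, §1 (1.7).
* [Katz2009] N. M. Katz, Another look at the Dwork family, Progr. Math. 270 (2009), §3, Lemma 3.1.
* [GriffithsHarris1978] P. Griffiths, J. Harris, Principles of Algebraic Geometry (1978), Ch. 1 §1.
-/

noncomputable section

open scoped Manifold ContDiff Topology LinearAlgebra.Projectivization
open Set Filter Projectivization

namespace Literature.AlgebraicGeometry.HodgeTheory

open Literature.NumberTheory.Transcendental Literature.Geometry.Kaehler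

/-! ### The gradient of an invariant form under a diagonal symmetry -/

section Gradient

variable {m : ℕ} {F : MvPolynomial (Fin (m + 2)) ℂ} {a : Fin (m + 2) → ℂˣ}

/-- The pointwise action of `(ℂˣ)^{m+2}` on `ℂ^{m+2}`: `(a • z)_k = a_k z_k` (the tree's
`units_smul_apply` of `DiagonalSymmetry`, repeated to keep this file's import cone analytic).
[folklore] -/
private theorem units_smul_apply (a : Fin (m + 2) → ℂˣ) (z : Fin (m + 2) → ℂ) (k : Fin (m + 2)) :
    (a • z) k = (a k : ℂ) * z k := rfl

/-- **The gradient of an `a`-invariant form is `a`-covariant**: if `F(a • z) = F(z)` for all `z`,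
then `a_j · (∂_jF)(a • z) = (∂_jF)(z)` — differentiate `F ∘ (a • ·) = F` at `z` (chain rule,
uniqueness of the Fréchet derivative) and evaluate on `e_j`. In print: `dF` is equivariant, so the
Jacobian ideal "does not depend on the choice of coordinates" (Voisin II, after Def. 6.9).
[cite: VoisinHodgeII2003, §6.1.3 Def. 6.9] -/
theorem mul_eval_pderiv_smul_of_eval_smul_eq
    (hFa : ∀ z, MvPolynomial.eval (a • z) F = MvPolynomial.eval z F) (z : Fin (m + 2) → ℂ)
    (j : Fin (m + 2)) :
    (a j : ℂ) * MvPolynomial.eval (a • z) (MvPolynomial.pderiv j F) =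
      MvPolynomial.eval z (MvPolynomial.pderiv j F) := by
  -- the linear map `w ↦ a • w`
  set A : (Fin (m + 2) → ℂ) →L[ℂ] (Fin (m + 2) → ℂ) :=
    ContinuousLinearMap.pi fun k ↦ ((a k : ℂ)) • ContinuousLinearMap.proj k with hA
  have hAw : ∀ w, A w = a • w := fun w ↦ by
    funext k
    simp [hA, Units.smul_def]
  -- `D(F ∘ A)(z) = dF(a • z) ∘ A` and `F ∘ A = F`
  have h1 : HasFDerivAt (fun w ↦ MvPolynomial.eval (a • w) F) ((polyGrad F (a • z)).comp A) z := by
    have h := (hasStrictFDerivAt_eval_polyGrad F (A z)).hasFDerivAt.comp z A.hasFDerivAt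
    rw [hAw z] at h
    exact h.congr_of_eventuallyEq (Eventually.of_forall fun w ↦ by
      simp only [Function.comp_apply, hAw])
  have h2 : HasFDerivAt (fun w ↦ MvPolynomial.eval (a • w) F) (polyGrad F z) z :=
    (hasStrictFDerivAt_eval_polyGrad F z).hasFDerivAt.congr_of_eventuallyEq
      (Eventually.of_forall fun w ↦ hFa w)
  have key := DFunLike.congr_fun (h1.unique h2) (Pi.single j 1)
  rw [ContinuousLinearMap.comp_apply, hAw, polyGrad_apply, polyGrad_apply,
    Finset.sum_eq_single j (fun k _ hk ↦ by simp [hk])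
      (fun h ↦ absurd (Finset.mem_univ j) h),
    Finset.sum_eq_single j (fun k _ hk ↦ by simp [hk]) (fun h ↦ absurd (Finset.mem_univ j) h)] at key
  simpa [Units.smul_def, mul_comm] using key

/-- **The partial derivatives on the scaled lift**: for `F` homogeneous of degree `d ≥ 1` with
`F(a • z) = F(z)`, and `δ = (a_k/a_i)_k`,
`(∂_jF)(δ · z) = (aᵢ⁻¹)^{d-1} · a_j⁻¹ · (∂_jF)(z)` (`δ · z = aᵢ⁻¹ • (a • z)`, homogeneity of
`∂_jF` of degree `d - 1`, and `mul_eval_pderiv_smul_of_eval_smul_eq`). [cite: VoisinHodgeII2003, §6.1.3] -/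
theorem eval_pderiv_diagScale {d : ℕ} (hF : F.IsHomogeneous d)
    (hFa : ∀ z, MvPolynomial.eval (a • z) F = MvPolynomial.eval z F) (i j : Fin (m + 2))
    (z : Fin (m + 2) → ℂ) :
    MvPolynomial.eval ((fun k ↦ ((a k : ℂ) / (a i : ℂ))) * z) (MvPolynomial.pderiv j F) =
      ((a i : ℂ)⁻¹) ^ (d - 1) * (((a j : ℂ))⁻¹ * MvPolynomial.eval z (MvPolynomial.pderiv j F)) := by
  have hδz : (fun k ↦ ((a k : ℂ) / (a i : ℂ))) * z = ((a i : ℂ))⁻¹ • (a • z) := by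
    funext k
    simp only [Pi.mul_apply, Pi.smul_apply, smul_eq_mul, units_smul_apply]
    ring
  have hj : MvPolynomial.eval (a • z) (MvPolynomial.pderiv j F) =
      ((a j : ℂ))⁻¹ * MvPolynomial.eval z (MvPolynomial.pderiv j F) := by
    rw [← mul_eval_pderiv_smul_of_eval_smul_eq hFa z j, ← mul_assoc, inv_mul_cancel₀ (a j).ne_zero,
      one_mul]
  rw [hδz, eval_smul_of_isHomogeneous hF.pderiv, hj]

/-- **The normal vector on the scaled lift**: `N_j(δ · z) = aᵢᵈ · (δ · N_j(z))` for
`N_j = e_j/∂_jF`, `δ = a/aᵢ`, `F` homogeneous of degree `d ≥ 1` with `F(a • z) = F(z)` — the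
`j`-th entries are `aᵢ^{d-1} a_j/∂_jF(z)` on both sides (`eval_pderiv_diagScale`). For
`aᵢᵈ = 1` (roots of unity, e.g. the Fermat and Dwork groups) this is the hypothesis `hN` of
`pullback_residueFormula_one_symm`. [cite: VoisinHodgeII2003, §6.1.3] -/
theorem normalVec_diagScale {d : ℕ} (hF : F.IsHomogeneous d)
    (hFa : ∀ z, MvPolynomial.eval (a • z) F = MvPolynomial.eval z F) (hd : 1 ≤ d)
    (i j : Fin (m + 2)) (z : Fin (m + 2) → ℂ) :
    normalVec F ((fun k ↦ ((a k : ℂ) / (a i : ℂ))) * z) j =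
      ((a i : ℂ) ^ d) • ((fun k ↦ ((a k : ℂ) / (a i : ℂ))) * normalVec F z j) := by
  obtain ⟨d', rfl⟩ : ∃ d', d = d' + 1 := ⟨d - 1, by omega⟩
  have hai : ((a i : ℂ)) ≠ 0 := (a i).ne_zero
  have haj : ((a j : ℂ)) ≠ 0 := (a j).ne_zero
  funext k
  simp only [normalVec, eval_pderiv_diagScale hF hFa i j z, Nat.add_sub_cancel, Pi.smul_apply,
    Pi.mul_apply, smul_eq_mul, Pi.single_apply]
  split_ifs with hk
  · subst hk
    rw [mul_inv, mul_inv, inv_pow, inv_inv, inv_inv]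
    field_simp
    ring
  · simp

end Gradient

/-! ### The local residue form under a diagonal symmetry, with a scaled normal vector -/

section Model

variable {m : ℕ} {E : Type*} [NormedAddCommGroup E] [NormedSpace ℂ E]
  {M : Type*} [TopologicalSpace M] [ChartedSpace E M]
  {ψ : M → ℙ ℂ (Fin (m + 2) → ℂ)} {a : Fin (m + 2) → ℂˣ} {Φ : M → M}
  (hΦ : ∀ x, ψ (Φ x) = Projectivization.mk ℂ (a • (ψ x).rep)
    ((smul_ne_zero_iff_ne a).mpr (Projectivization.rep_nonzero _)))

include hΦ in
/-- **`Φ^* ω = (c · ∏_k a_k/a_i) • ω` for the local residue form `ω = det(N_j, Z̃ᵢ, dZ̃ᵢ ·)` on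
`Mᵢ`**, when the normal vector scales as `N_j(δ · Z̃ᵢ x) = c · δ · N_j(Z̃ᵢ x)`, `δ = a/aᵢ`
(`pullback_residueFormula_one_symm` is the case `c = 1`): `(Φ^*ω)(x) = det(cδN, δz, δ dZ̃ᵢ(x) ·) =
c (∏ δ_k) ω(x)` (`projLift_symm`, `liftDeriv_symm_apply`, `coneResidue_smul_left`,
`coneResidue_diag`). [cite: VoisinHodgeII2003, §6.1.3] [cite: Shioda1979HodgeFermat, §1 (1.7)] -/
theorem pullback_residueFormula_one_symm_of_smul (hψ : Continuous ψ) (hhol : HasHolomorphicCoords E ψ)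
    (hΦd : MDifferentiable 𝓘(ℂ, E) 𝓘(ℂ, E) Φ) {F : MvPolynomial (Fin (m + 2)) ℂ}
    {i j : Fin (m + 2)} {x : M} (hx : x ∈ liftDomain ψ i) {c : ℂ}
    (hN : normalVec F ((fun k ↦ ((a k : ℂ) / (a i : ℂ))) * projLift ψ i x) j =
      c • ((fun k ↦ ((a k : ℂ) / (a i : ℂ))) * normalVec F (projLift ψ i x) j))
    {ω₀ : MForm 𝓘(ℝ, E) M ℂ m}
    (hωx : ω₀ x = (show E [⋀^Fin m]→L[ℝ] ℂ from
      (residueFormula (E := E) ψ F 1 i j x).restrictScalars ℝ))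
    (hωΦx : ω₀ (Φ x) = (show E [⋀^Fin m]→L[ℝ] ℂ from
      (residueFormula (E := E) ψ F 1 i j (Φ x)).restrictScalars ℝ)) :
    ω₀.pullback 𝓘(ℝ, E) Φ x = (c * ∏ k, ((a k : ℂ) / (a i : ℂ))) • ω₀ x := by
  set δ : Fin (m + 2) → ℂ := fun k ↦ ((a k : ℂ) / (a i : ℂ)) with hδ
  have hz : projLift ψ i (Φ x) = δ * projLift ψ i x := (projLift_symm hΦ hx).2
  -- the composed differential `dZ̃ᵢ(Φ x) ∘ dΦ(x)` as a plain linear map, scaling by `δ`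
  set T : E →L[ℂ] (Fin (m + 2) → ℂ) := (liftDeriv (E := E) ψ i (Φ x)).comp
    (show E →L[ℂ] E from mfderiv 𝓘(ℂ, E) 𝓘(ℂ, E) Φ x) with hT
  have hTv : ∀ v, T v = δ * liftDeriv (E := E) ψ i x v := fun v ↦
    liftDeriv_symm_apply hΦ hψ hhol hΦd hx v
  have hcone : coneResidue (normalVec F (projLift ψ i (Φ x)) j) (projLift ψ i (Φ x)) T =
      (c * ∏ k, δ k) • coneResidue (normalVec F (projLift ψ i x) j) (projLift ψ i x)
        (liftDeriv (E := E) ψ i x) := by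
    rw [hz, hN, coneResidue_smul_left, coneResidue_diag δ _ _ _ T hTv, smul_smul]
  -- evaluate both sides on `v`
  ext v
  have hreal := mfderiv_real_eq_restrictScalars (hΦd x)
  have lhs : ω₀.pullback 𝓘(ℝ, E) Φ x v =
      coneResidue (normalVec F (projLift ψ i (Φ x)) j) (projLift ψ i (Φ x)) T v := by
    rw [MForm.pullback_apply, hωΦx, hreal]
    change (residueFormula (E := E) ψ F 1 i j (Φ x)) (fun k ↦ mfderiv 𝓘(ℂ, E) 𝓘(ℂ, E) Φ x (v k)) = _
    rw [residueFormula, map_one, one_smul, coneResidue_apply, coneResidue_apply]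
    rfl
  have rhs : ((c * ∏ k, δ k) • ω₀ x) v =
      ((c * ∏ k, δ k) • coneResidue (normalVec F (projLift ψ i x) j) (projLift ψ i x)
        (liftDeriv (E := E) ψ i x)) v := by
    rw [ContinuousAlternatingMap.smul_apply, ContinuousAlternatingMap.smul_apply, hωx]
    change (c * ∏ k, δ k) • (residueFormula (E := E) ψ F 1 i j x) v = _
    rw [residueFormula, map_one, one_smul]
  rw [lhs, rhs, hcone]

/-! ### Degree `d = m + 2`: `Res(Ω/F)` is a nowhere-vanishing holomorphic top form transforming by `det` -/

variable {F : MvPolynomial (Fin (m + 2)) ℂ}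

omit hΦ in
/-- The constant `1` is homogeneous of degree `(m + 2) - (m + 2)` (bookkeeping for `P = 1`).
[folklore] -/
private theorem isHomogeneous_one_sub_self :
    (1 : MvPolynomial (Fin (m + 2)) ℂ).IsHomogeneous (m + 2 - (m + 2)) := by
  rw [Nat.sub_self]
  exact MvPolynomial.isHomogeneous_one _ _

include hΦ in
/-- **`Φ^* Res(Ω/F) = (∏_k a_k) • Res(Ω/F)` for a hypersurface of degree `d = m + 2`.** For `F`
homogeneous of degree `m + 2` with non-vanishing gradient on its cone and `F(a • z) = F(z)`,
`ψ` an embedding into `V(F)` with holomorphic affine coordinates and `Φ` holomorphic over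
`[z] ↦ [a • z]`, the residue form `residueForm ψ F 1 = ψ^* Res_Y(Ω/F)` satisfies
`Φ^* Res = (∏_k a_k) • Res` on all of `M`: at `x ∈ Mᵢ` with `∂_jF(Z̃ᵢ x) ≠ 0` both `x` and `Φ x`
are in the domain of the local formula with indices `(i, j)` (`residueForm_eventuallyEq`;
`∂_jF(Z̃ᵢ(Φ x)) = aᵢ^{-(m+1)} a_j⁻¹ ∂_jF(Z̃ᵢ x) ≠ 0`), and there
`Φ^*ω = aᵢ^{m+2} (∏_k a_k/aᵢ) ω = (∏_k a_k) ω` (`pullback_residueFormula_one_symm_of_smul`,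
`normalVec_diagScale`). In print: `g^* Res(Ω/F) = det(g) Res(Ω/F)` — the holomorphic volume form of a
Calabi–Yau hypersurface transforms by the determinant (Voisin II, §6.1.3; Shioda (1.7): the
character of `μₘⁿ⁺²` on `H^{n,0}(Xⁿₘ)` is `a ↦ ∏ aᵢ`; Katz 2009, §3).
[cite: VoisinHodgeII2003, §6.1.3] [cite: Shioda1979HodgeFermat, §1 (1.7)] [cite: Katz2009, §3] -/
theorem pullback_residueForm_one_symm (hF : F.IsHomogeneous (m + 2)) (hψ : Topology.IsEmbedding ψ)
    (hrange : Set.range ψ ⊆ projZeroLocus {F})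
    (hjac : ∀ z : Fin (m + 2) → ℂ, z ≠ 0 → MvPolynomial.eval z F = 0 →
      ∃ j, MvPolynomial.eval z (MvPolynomial.pderiv j F) ≠ 0)
    (hhol : HasHolomorphicCoords E ψ) (hΦd : MDifferentiable 𝓘(ℂ, E) 𝓘(ℂ, E) Φ)
    (hFa : ∀ z, MvPolynomial.eval (a • z) F = MvPolynomial.eval z F) :
    (residueForm (E := E) ψ F 1).pullback 𝓘(ℝ, E) Φ = (∏ k, ((a k : ℂ))) • residueForm (E := E) ψ F 1 := by
  funext x
  set i := residueIdx ψ x with hidef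
  have hx : x ∈ liftDomain ψ i := residueIdx_spec ψ x
  obtain ⟨j, hj⟩ := hjac _ (projLift_ne_zero ψ i x) (eval_projLift_eq_zero ψ hF hrange hx)
  have hai : ((a i : ℂ)) ≠ 0 := (a i).ne_zero
  have haj : ((a j : ℂ)) ≠ 0 := (a j).ne_zero
  -- `(i, j)` is admissible at `Φ x` too
  have hΦx : Φ x ∈ liftDomain ψ i := mem_liftDomain_symm hΦ hx
  have hjΦ : MvPolynomial.eval (projLift ψ i (Φ x)) (MvPolynomial.pderiv j F) ≠ 0 := by
    rw [(projLift_symm hΦ hx).2, eval_pderiv_diagScale hF hFa i j]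
    exact mul_ne_zero (pow_ne_zero _ (inv_ne_zero hai)) (mul_ne_zero (inv_ne_zero haj) hj)
  -- the local formula at `x` and at `Φ x`
  have hωx := (residueForm_eventuallyEq ψ hF hψ.continuous hrange hjac hhol
    isHomogeneous_one_sub_self le_rfl hx hj).self_of_nhds
  have hωΦx := (residueForm_eventuallyEq ψ hF hψ.continuous hrange hjac hhol
    isHomogeneous_one_sub_self le_rfl hΦx hjΦ).self_of_nhds
  have key := pullback_residueFormula_one_symm_of_smul hΦ hψ.continuous hhol hΦd hx
    (normalVec_diagScale hF hFa (by omega) i j (projLift ψ i x)) hωx hωΦx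
  rw [key, Pi.smul_apply]
  congr 1
  rw [Finset.prod_div_distrib, Finset.prod_const, Finset.card_univ, Fintype.card_fin,
    mul_div_cancel₀ _ (pow_ne_zero _ hai)]

omit hΦ in
/-- **`Res(Ω/F)` vanishes nowhere for `d = m + 2`**: at every `x ∈ M` the residue form
`residueForm ψ F 1` is non-zero (`residueForm_ne_zero` with `P = X_{i₀}^{d-m-2} = X_{i₀}⁰ = 1`,
`i₀` the chart index at `x`; `dim_ℂ E = m`). In print: `Res(Ω/F)` is a nowhere-vanishing section
of `K_Y = 𝒪_Y(d - m - 2) = 𝒪_Y`; locally `± dx_K/(∂f/∂x_j)`.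
[cite: VoisinHodgeII2003, §6.1.3, Thm. 6.10 and Cor. 6.12 (p = 1)] -/
theorem residueForm_one_ne_zero [FiniteDimensional ℂ E] [IsManifold 𝓘(ℂ, E) ω M] (hF : F.IsHomogeneous (m + 2))
    (hψ : Topology.IsEmbedding ψ) (hrange : Set.range ψ ⊆ projZeroLocus {F})
    (hjac : ∀ z : Fin (m + 2) → ℂ, z ≠ 0 → MvPolynomial.eval z F = 0 →
      ∃ j, MvPolynomial.eval z (MvPolynomial.pderiv j F) ≠ 0)
    (hhol : HasHolomorphicCoords E ψ) (hdim : Module.finrank ℂ E = m) (x : M) :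
    residueForm (E := E) ψ F 1 x ≠ 0 := by
  have h := residueForm_ne_zero ψ hF hψ hrange hjac hhol hdim le_rfl (residueIdx_spec ψ x)
  rwa [Nat.sub_self, pow_zero] at h

omit hΦ in
/-- **`Res(Ω/F)` is holomorphic in charts for `d = m + 2`** (`isHolomorphicInCharts_residueForm`
with `P = 1`). [cite: VoisinHodgeII2003, §6.1.1 and §6.1.3] -/
theorem isHolomorphicInCharts_residueForm_one [FiniteDimensional ℂ E] [IsManifold 𝓘(ℂ, E) ω M]
    [IsManifold 𝓘(ℝ, E) ∞ M]
    (hF : F.IsHomogeneous (m + 2)) (hψ : Continuous ψ) (hrange : Set.range ψ ⊆ projZeroLocus {F})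
    (hjac : ∀ z : Fin (m + 2) → ℂ, z ≠ 0 → MvPolynomial.eval z F = 0 →
      ∃ j, MvPolynomial.eval z (MvPolynomial.pderiv j F) ≠ 0)
    (hhol : HasHolomorphicCoords E ψ) :
    IsHolomorphicInCharts (residueForm (E := E) ψ F 1) :=
  isHolomorphicInCharts_residueForm ψ hF hψ hrange hjac hhol isHomogeneous_one_sub_self le_rfl

omit hΦ in
/-- **On a compact connected model of a hypersurface of degree `d = m + 2`, every holomorphic
`m`-form is a constant multiple of `Res(Ω/F)`** (`Literature.Geometry.Kaehler.exists_eq_const_smul_of_isHolomorphicInCharts`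
with the nowhere-vanishing holomorphic top form `residueForm ψ F 1`). In print:
`H⁰(Y, K_Y) = R_F⁰ · Res(Ω/F) = ℂ · Res(Ω/F)`, `p_g(Y) = 1` (Voisin II, Cor. 6.12 at `p = 1`;
Hartshorne II, Example 8.20.3 with `d = n + 1`). [cite: VoisinHodgeII2003, §6.1.3 Cor. 6.12 (p = 1)]
[cite: GriffithsHarris1978, Ch. 1 §1] -/
theorem exists_eq_const_smul_residueForm_one [FiniteDimensional ℂ E] [IsManifold 𝓘(ℂ, E) ω M]
    [IsManifold 𝓘(ℝ, E) ∞ M] [CompactSpace M] [PreconnectedSpace M]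
    (hF : F.IsHomogeneous (m + 2)) (hψ : Topology.IsEmbedding ψ)
    (hrange : Set.range ψ ⊆ projZeroLocus {F})
    (hjac : ∀ z : Fin (m + 2) → ℂ, z ≠ 0 → MvPolynomial.eval z F = 0 →
      ∃ j, MvPolynomial.eval z (MvPolynomial.pderiv j F) ≠ 0)
    (hhol : HasHolomorphicCoords E ψ) (hdim : Module.finrank ℂ E = m)
    {η : MForm 𝓘(ℝ, E) M ℂ m} (hη : IsHolomorphicInCharts η) :
    ∃ c : ℂ, η = c • residueForm (E := E) ψ F 1 :=
  exists_eq_const_smul_of_isHolomorphicInCharts hdim hη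
    (isHolomorphicInCharts_residueForm_one hF hψ.continuous hrange hjac hhol)
    (residueForm_one_ne_zero hF hψ hrange hjac hhol hdim)

include hΦ in
/-- **Every holomorphic top form of a compact connected model of a hypersurface of degree
`d = m + 2` transforms by `det` under a diagonal symmetry**: `Φ^* η = (∏_k a_k) • η`
(`η = c • Res(Ω/F)` by `exists_eq_const_smul_residueForm_one`, and `pullback_residueForm_one_symm`).
In print: `H^{m,0}(Y)` is the character `det` of the group of diagonal symmetries of `F`
(Shioda 1979, (1.7): `V(α) ⊂ H^{n,0}(Xⁿₘ)` only for `α = (1, …, 1)`; Katz 2009, §3 for the Dwork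
family). [cite: Shioda1979HodgeFermat, §1 (1.7)] [cite: Katz2009, §3 and Lemma 3.1]
[cite: VoisinHodgeII2003, §6.1.3] -/
theorem pullback_eq_prod_smul_of_isHolomorphicInCharts [FiniteDimensional ℂ E]
    [IsManifold 𝓘(ℂ, E) ω M] [IsManifold 𝓘(ℝ, E) ∞ M] [CompactSpace M] [PreconnectedSpace M]
    (hF : F.IsHomogeneous (m + 2)) (hψ : Topology.IsEmbedding ψ)
    (hrange : Set.range ψ ⊆ projZeroLocus {F})
    (hjac : ∀ z : Fin (m + 2) → ℂ, z ≠ 0 → MvPolynomial.eval z F = 0 →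
      ∃ j, MvPolynomial.eval z (MvPolynomial.pderiv j F) ≠ 0)
    (hhol : HasHolomorphicCoords E ψ) (hdim : Module.finrank ℂ E = m)
    (hΦd : MDifferentiable 𝓘(ℂ, E) 𝓘(ℂ, E) Φ)
    (hFa : ∀ z, MvPolynomial.eval (a • z) F = MvPolynomial.eval z F)
    {η : MForm 𝓘(ℝ, E) M ℂ m} (hη : IsHolomorphicInCharts η) :
    η.pullback 𝓘(ℝ, E) Φ = (∏ k, ((a k : ℂ))) • η := by
  obtain ⟨c, rfl⟩ := exists_eq_const_smul_residueForm_one hF hψ hrange hjac hhol hdim hη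
  have hsm : (c • residueForm (E := E) ψ F 1).pullback 𝓘(ℝ, E) Φ =
      c • (residueForm (E := E) ψ F 1).pullback 𝓘(ℝ, E) Φ := by
    funext x
    ext v
    simp [MForm.pullback_apply]
  rw [hsm, pullback_residueForm_one_symm hΦ hF hψ hrange hjac hhol hΦd hFa, smul_comm]

include hΦ in
/-- **An eigenform of a diagonal symmetry with eigenvalue `χ ≠ ∏_k a_k` vanishes** (degree
`d = m + 2`, compact connected model): if `Φ^* η = χ • η` for a holomorphic `m`-form `η` and
`χ ≠ ∏_k a_k`, then `η = 0` — since also `Φ^* η = (∏_k a_k) • η`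
(`pullback_eq_prod_smul_of_isHolomorphicInCharts`). In print: the isotypic components of
`H^{m,0}(Y)` for characters other than `det` are zero (Shioda (1.7); Katz 2009, Lemma 3.1: on the
Dwork family `H^{n,0}` lies in the `Γ_W`-invariants, `∏ aᵢ = 1` on `Γ_W`).
[cite: Shioda1979HodgeFermat, §1 (1.7)] [cite: Katz2009, §3 and Lemma 3.1] -/
theorem eq_zero_of_pullback_eq_smul_of_ne [FiniteDimensional ℂ E]
    [IsManifold 𝓘(ℂ, E) ω M] [IsManifold 𝓘(ℝ, E) ∞ M] [CompactSpace M] [PreconnectedSpace M]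
    (hF : F.IsHomogeneous (m + 2)) (hψ : Topology.IsEmbedding ψ)
    (hrange : Set.range ψ ⊆ projZeroLocus {F})
    (hjac : ∀ z : Fin (m + 2) → ℂ, z ≠ 0 → MvPolynomial.eval z F = 0 →
      ∃ j, MvPolynomial.eval z (MvPolynomial.pderiv j F) ≠ 0)
    (hhol : HasHolomorphicCoords E ψ) (hdim : Module.finrank ℂ E = m)
    (hΦd : MDifferentiable 𝓘(ℂ, E) 𝓘(ℂ, E) Φ)
    (hFa : ∀ z, MvPolynomial.eval (a • z) F = MvPolynomial.eval z F)
    {η : MForm 𝓘(ℝ, E) M ℂ m} (hη : IsHolomorphicInCharts η) {χ : ℂ}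
    (heig : η.pullback 𝓘(ℝ, E) Φ = χ • η) (hχ : χ ≠ ∏ k, ((a k : ℂ))) : η = 0 := by
  have h := pullback_eq_prod_smul_of_isHolomorphicInCharts hΦ hF hψ hrange hjac hhol hdim hΦd hFa hη
  rw [heig] at h
  have h0 : (χ - ∏ k, ((a k : ℂ))) • η = 0 := by rw [sub_smul, h, sub_self]
  exact (smul_eq_zero.1 h0).resolve_left (sub_ne_zero.2 hχ)

end Model

end Literature.AlgebraicGeometry.HodgeTheory

end
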